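import Summits.KontsevichZagierPeriods.KontsevichZagierPeriods.Theorems.LinRedNormalFormArrangementNormalFormSeparateEngine

/-!
# Cancelling a fat letter: the divergent box (stub `stub_separateThreeZero`, part `FatBox`)

(Line `janus-bands`, crux `ArrangementNormalForm`, stub `stub_separateThreeZero` — fibre-free
separation over a bounded rational polytope in `ℝ³`, `JJ 3 0 → closure (GG 2 1 0)`; part
`FatBox` of the CANCELLATION lemma `JJ 3 0 ≡ thin JJ 3 0`.)

The measure-theoretic core of the cancellation of a fat letter: `w ↦ w⁻¹` is not integrable on a
box `S × (a, b)` with `0 ∈ [a, b]`, `vol S > 0` (`SepThree.fat_not_integrableOn_box`, Fubini),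
and the transfer of integrability along the measure-preserving VERTICAL SHEAR CHART
`(v, w) ↦ (x₀ + v, w + λ(x₀ + v))` of `ℝ³` (`SepThree.fat_shear_transfer`, registered as
`separateThree_fat_shear`), in which the pole plane `y = λ(x')` becomes `w = 0`. No definition is
introduced: the chart is the explicit `Fin.snoc` expression.
-/

noncomputable section

open Set MeasureTheory Filter Topology
open scoped ENNReal

namespace Summit.KontsevichZagierPeriods.ArrangementNormalForm.JanusBands

namespace SepThree

/-! ### Non-integrability of `w⁻¹` across `w = 0` -/

/-- `w⁻¹` is not integrable on an interval whose closure contains `0`. -/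
theorem fat_not_integrableOn_inv {a b : ℝ} (hab : a < b) (h0 : (0 : ℝ) ∈ Set.uIcc a b) :
    ¬ IntegrableOn (fun w : ℝ => w⁻¹) (Ioo a b) := by
  intro h
  have h1 : IntervalIntegrable (fun w : ℝ => w⁻¹) volume a b :=
    (intervalIntegrable_iff_integrableOn_Ioo_of_le hab.le).2 h
  rw [intervalIntegrable_inv_iff] at h1
  rcases h1 with h1 | h1
  · exact absurd h1 hab.ne
  · exact h1 h0

/-- **The divergent box**: `(v, w) ↦ w⁻¹` is not integrable on `S × (a, b)` when `0 ∈ [a, b]` and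
`S` has positive measure. -/
theorem fat_not_integrableOn_box {S : Set (Fin 2 → ℝ)} (hS0 : volume S ≠ 0) {a b : ℝ}
    (hab : a < b) (h0 : (0 : ℝ) ∈ Set.uIcc a b) :
    ¬ IntegrableOn (fun q : (Fin 2 → ℝ) × ℝ => q.2⁻¹) (S ×ˢ Ioo a b) := by
  intro h
  rw [IntegrableOn, Measure.volume_eq_prod, ← Measure.prod_restrict] at h
  have hm : AEStronglyMeasurable (fun q : (Fin 2 → ℝ) × ℝ => q.2⁻¹)
      ((volume.restrict S).prod (volume.restrict (Ioo a b))) :=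
    (measurable_snd.inv).aestronglyMeasurable
  have h1 := ((integrable_prod_iff hm).1 h).1
  have h2 : ∀ᵐ _ ∂(volume.restrict S), False := by
    filter_upwards [h1] with v hv
    exact fat_not_integrableOn_inv hab h0 hv
  rw [eventually_false_iff_eq_bot, ae_eq_bot, Measure.restrict_eq_zero] at h2
  exact hS0 h2

/-! ### The vertical shear chart -/

/-- **The vertical shear chart** `(v, w) ↦ (x₀ + v, w + λ(x₀ + v))`, `λ(u) = κ₀ u₀ + κ₁ u₁ + c`,
is a measure-preserving measurable equivalence `ℝ² × ℝ ≃ ℝ³` (vertical shear of `ℝ² × ℝ`,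
`MeasurePreserving.skew_product`; swap; `MeasurableEquiv.piFinSuccAbove` at the last index):
integrability transfers from the image of a set to the set. -/
theorem fat_shear_transfer (x₀ κ : Fin 2 → ℝ) (c : ℝ) {f : (Fin (2 + 1) → ℝ) → ℝ}
    {B : Set ((Fin 2 → ℝ) × ℝ)}
    (h : IntegrableOn f ((fun q : (Fin 2 → ℝ) × ℝ => (Fin.snoc (x₀ + q.1)
      (q.2 + (κ 0 * (x₀ 0 + q.1 0) + κ 1 * (x₀ 1 + q.1 1) + c)) : Fin (2 + 1) → ℝ)) '' B)) :
    IntegrableOn (fun q : (Fin 2 → ℝ) × ℝ => f (Fin.snoc (x₀ + q.1)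
      (q.2 + (κ 0 * (x₀ 0 + q.1 0) + κ 1 * (x₀ 1 + q.1 1) + c)))) B := by
  -- the affine function of the base point
  set lam : (Fin 2 → ℝ) → ℝ := fun u => κ 0 * u 0 + κ 1 * u 1 + c with hlam
  have hlamc : Continuous lam := by rw [hlam]; fun_prop
  -- the shear of `ℝ² × ℝ`
  let e₁ : (Fin 2 → ℝ) × ℝ ≃ₜ (Fin 2 → ℝ) × ℝ :=
    { toFun := fun q => (x₀ + q.1, q.2 + lam (x₀ + q.1))
      invFun := fun q => (q.1 - x₀, q.2 - lam q.1)
      left_inv := fun q => by ext <;> simp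
      right_inv := fun q => by ext <;> simp
      continuous_toFun := by fun_prop
      continuous_invFun := by fun_prop }
  have he₁ : MeasurePreserving e₁ volume volume := by
    have := (measurePreserving_add_left (volume : Measure (Fin 2 → ℝ)) x₀).skew_product
      (g := fun v w => w + lam (x₀ + v)) (by fun_prop)
      (Eventually.of_forall fun v => (measurePreserving_add_right (volume : Measure ℝ)
        (lam (x₀ + v))).map_eq)
    rw [Measure.volume_eq_prod]
    exact this
  -- the chart
  let e : (Fin 2 → ℝ) × ℝ ≃ᵐ (Fin (2 + 1) → ℝ) :=
    e₁.toMeasurableEquiv.trans (MeasurableEquiv.prodComm.trans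
      (MeasurableEquiv.piFinSuccAbove (fun _ => ℝ) (Fin.last 2)).symm)
  have he_apply : ∀ q, e q = Fin.snoc (x₀ + q.1) (q.2 + lam (x₀ + q.1)) := fun q => by
    simp only [e, MeasurableEquiv.trans_apply, Homeomorph.toMeasurableEquiv_coe,
      MeasurableEquiv.prodComm, MeasurableEquiv.coe_mk, Equiv.prodComm_apply,
      MeasurableEquiv.piFinSuccAbove_symm_apply, Fin.insertNthEquiv, Prod.swap, Equiv.coe_fn_mk,
      Fin.insertNth_last']
    rfl
  have he : MeasurePreserving e volume volume := by
    refine he₁.trans ?_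
    refine MeasurePreserving.trans (μb := volume) ?_
      (volume_preserving_piFinSuccAbove (fun _ : Fin (2 + 1) => ℝ) (Fin.last 2)).symm
    rw [Measure.volume_eq_prod, Measure.volume_eq_prod]
    exact Measure.measurePreserving_swap
  have hfun : (fun q : (Fin 2 → ℝ) × ℝ => (Fin.snoc (x₀ + q.1)
      (q.2 + (κ 0 * (x₀ 0 + q.1 0) + κ 1 * (x₀ 1 + q.1 1) + c)) : Fin (2 + 1) → ℝ)) = e :=
    funext fun q => (he_apply q).symm
  rw [hfun] at h
  have key := (he.integrableOn_comp_preimage e.measurableEmbedding (f := f) (s := e '' B)).2 h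
  rw [e.injective.preimage_image] at key
  have hg : (fun q : (Fin 2 → ℝ) × ℝ => f (Fin.snoc (x₀ + q.1)
      (q.2 + (κ 0 * (x₀ 0 + q.1 0) + κ 1 * (x₀ 1 + q.1 1) + c)))) = f ∘ e :=
    funext fun q => by rw [Function.comp_apply, he_apply]; simp [hlam, Pi.add_apply]
  rw [hg]
  exact key

end SepThree

open SepThree in
/-- **Transfer of integrability along the vertical shear chart of `ℝ³`** (registered sub-goal of
`stub_separateThreeZero`, part `FatBox`; see `SepThree.fat_shear_transfer`). -/
theorem separateThree_fat_shear (x₀ κ : Fin 2 → ℝ) (c : ℝ) (f : (Fin (2 + 1) → ℝ) → ℝ) (B : Set ((Fin 2 → ℝ) × ℝ)) (h : MeasureTheory.IntegrableOn f ((fun q : (Fin 2 → ℝ) × ℝ => (Fin.snoc (x₀ + q.1) (q.2 + (κ 0 * (x₀ 0 + q.1 0) + κ 1 * (x₀ 1 + q.1 1) + c)) : Fin (2 + 1) → ℝ)) '' B)) : MeasureTheory.IntegrableOn (fun q : (Fin 2 → ℝ) × ℝ => f (Fin.snoc (x₀ + q.1) (q.2 + (κ 0 * (x₀ 0 + q.1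 0) + κ 1 * (x₀ 1 + q.1 1) + c)))) B :=
  fat_shear_transfer x₀ κ c h

end Summit.KontsevichZagierPeriods.ArrangementNormalForm.JanusBands
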